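import Summits.KontsevichZagierPeriods.KontsevichZagierPeriods.Theorems.HyperbolicBlochOffTetraSectorKernelStubConeAbsorptionTwoMain

/-!
# `OffTetraSectorKernel` (stmt-KontsevichZagierPeriods-10557) — line `odd-hyperbolic-ladder` (skeleton v3),
registered stub `stub_coneAbsorptionTwo` (lead-held)

A `ℚ̄`-CONE of hyperbolic 3-space — the open geodesic simplex `Spx (vecCons (Ql q) n)` spanned by the lift of an
algebraic finite point `q` of the upper half space and three algebraic ideal rows — carries a Kontsevich–Zagier
representation with integrand `t⁻³`, and TWICE its class is, modulo the moves, a `ℤ`-combination of standard ideal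
tetrahedra `[ρ z] = [idealTetrahedron z, t⁻³]`. Proof: the boundary similarity `p ↦ ((p₀−q₀)/q₂, (p₁−q₁)/q₂, p₂/q₂)`
(ONE move, `IsometryMove.simil_transport`; Lorentz matrix `Mh q` of `…Aux.lean`, image by `stub_spxCovariance`)
puts the apex at `(0,0,1)`, where `coneMain_absorption_normalised` (three lunes and the point reflection) applies.
Together with the landed `stub_tetraHalving` and integer division this absorbs every cone class into the tetrahedral
envelope (skeleton v3, `cone_mem_envelope`). [Dupont–Sah 1982, §3]
-/

noncomputable section

open Set MeasureTheory
open Literature.NumberTheory.Transcendental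

namespace Summit.KontsevichZagierPeriods.HyperbolicBloch.OffTetraSectorKernel

/-! ### Normalising the apex and the registered stub -/

/-- **The lead-held stub**, for pinned functionals `Ql`, `Spx` and the Lorentz matrices `M₀`, `Mh q`. -/
theorem coneAbsorptionTwo_pinned (Ql : (Fin 3 → ℝ) → Fin 4 → ℝ) (hQl : ∀ p, Ql p = ![p 0 ^ 2 + p 1 ^ 2 + p 2 ^ 2, p 0, p 1, 1])
    (Spx : (Fin 4 → Fin 4 → ℝ) → Set (Fin 3 → ℝ))
    (hSpx : ∀ v, Spx v = {p | 0 < p 2 ∧ ∀ a, 0 < (Matrix.of v).det * ((Matrix.of v).updateRow a (Ql p)).det})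
    (M₀ : Matrix (Fin 4) (Fin 4) ℝ) (hM₀ : M₀ = !![0, 0, 0, 1; 0, -1, 0, 0; 0, 0, -1, 0; 1, 0, 0, 0])
    (q : Fin 3 → ℝ) (Mh : Matrix (Fin 4) (Fin 4) ℝ)
    (hMh : Mh = !![1 / q 2 ^ 2, -2 * q 0 / q 2 ^ 2, -2 * q 1 / q 2 ^ 2, (q 0 ^ 2 + q 1 ^ 2) / q 2 ^ 2;
      0, 1 / q 2, 0, -q 0 / q 2; 0, 0, 1 / q 2, -q 1 / q 2; 0, 0, 0, 1])
    (ρ : ℂ → KZ.IntegralRep 3)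
    (hρ : ∀ z, IsAlgebraic ℚ z → 0 < z.im →
      (ρ z).domain = idealTetrahedron z ∧ EqOn (ρ z).integrand (fun p => 1 / p 2 ^ 3) (idealTetrahedron z))
    (hq : ∀ i, IsAlgebraic ℚ (q i)) (hq2 : 0 < q 2)
    (n : Fin 3 → Fin 4 → ℝ) (hn : ∀ i j, IsAlgebraic ℚ (n i j)) (hnull : ∀ i, (fun x : Fin 4 → ℝ => x 1 ^ 2 + x 2 ^ 2 = x 0 * x 3 ∧ 0 ≤ x 3 ∧ 0 < x 0 + x 3) (n i))
    (hdet : (Matrix.of (Matrix.vecCons (Ql q) n)).det ≠ 0) :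
    (∃ r : KZ.IntegralRep 3, r.domain = Spx (Matrix.vecCons (Ql q) n) ∧
      EqOn r.integrand (fun p => 1 / p 2 ^ 3) r.domain) ∧
    (∀ r : KZ.IntegralRep 3, r.domain = Spx (Matrix.vecCons (Ql q) n) →
      EqOn r.integrand (fun p => 1 / p 2 ^ 3) r.domain →
      ∃ (k : ℕ) (z : Fin k → ℂ) (e : Fin k → ℤ), (∀ i, IsAlgebraic ℚ (z i)) ∧ (∀ i, 0 < (z i).im) ∧
        2 • KZ.of r - ∑ i, e i • KZ.of (ρ (z i)) ∈ KZ.relations) := by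
  classical
  -- the normalising similarity `S` and its inverse `S'`, pinned by equations
  obtain ⟨S, hS⟩ : ∃ S : (Fin 3 → ℝ) → (Fin 3 → ℝ), ∀ p, S p =
      ![(((q 2 : ℂ)⁻¹) * (Complex.mk (p 0) (1 * p 1)) + (-(Complex.mk (q 0) (q 1)) * (q 2 : ℂ)⁻¹)).re,
        (((q 2 : ℂ)⁻¹) * (Complex.mk (p 0) (1 * p 1)) + (-(Complex.mk (q 0) (q 1)) * (q 2 : ℂ)⁻¹)).im,
        ‖((q 2 : ℂ)⁻¹)‖ * p 2] := ⟨_, fun _ => rfl⟩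
  have hSa : ∀ p, S p = ![(p 0 - q 0) / q 2, (p 1 - q 1) / q 2, p 2 / q 2] := coneAux_simil_normalise_apply q hq2 S hS
  obtain ⟨S', hS'⟩ : ∃ S' : (Fin 3 → ℝ) → (Fin 3 → ℝ), ∀ p, S' p =
      ![((q 2 : ℂ) * (Complex.mk (p 0) (1 * p 1)) + (Complex.mk (q 0) (q 1))).re,
        ((q 2 : ℂ) * (Complex.mk (p 0) (1 * p 1)) + (Complex.mk (q 0) (q 1))).im,
        ‖(q 2 : ℂ)‖ * p 2] := ⟨_, fun _ => rfl⟩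
  have hS'a : ∀ p, S' p = ![q 2 * p 0 + q 0, q 2 * p 1 + q 1, q 2 * p 2] := by
    intro p; rw [hS']
    have hn : ‖(q 2 : ℂ)‖ = q 2 := by rw [Complex.norm_real, Real.norm_eq_abs, abs_of_pos hq2]
    rw [hn]
    ext i; fin_cases i <;> simp
  have hq0 : q 2 ≠ 0 := hq2.ne'
  have hS'S : ∀ p, S' (S p) = p := by
    intro p; rw [hS'a, hSa]
    ext i
    fin_cases i
    · simp; field_simp; ring
    · simp; field_simp; ring
    · simp; field_simp
  have hSS' : ∀ p, S (S' p) = p := by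
    intro p; rw [hSa, hS'a]
    ext i
    fin_cases i
    · simp; field_simp
    · simp; field_simp
    · simp; field_simp
  -- algebraic parameters
  have hq2c : IsAlgebraic ℚ ((q 2 : ℂ)) := by
    simpa using (hq 2).algebraMap (A := ℂ)
  have hqc : IsAlgebraic ℚ (Complex.mk (q 0) (q 1)) := by
    have e : Complex.mk (q 0) (q 1) = (q 0 : ℂ) + (q 1 : ℂ) * Complex.I := by
      apply Complex.ext <;> simp
    have hI : IsAlgebraic ℚ Complex.I := by
      refine ⟨Polynomial.X ^ 2 + 1, ?_, ?_⟩
      · intro h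
        have h2 := congrArg (Polynomial.eval 0) h
        simp at h2
      · simp [Complex.I_sq]
    rw [e]
    exact ((hq 0).algebraMap (A := ℂ)).add (((hq 1).algebraMap (A := ℂ)).mul hI)
  have hα : IsAlgebraic ℚ ((q 2 : ℂ)⁻¹) := hq2c.inv
  have hβ : IsAlgebraic ℚ (-(Complex.mk (q 0) (q 1)) * (q 2 : ℂ)⁻¹) := hqc.neg.mul hα
  have hα0 : ((q 2 : ℂ)⁻¹) ≠ 0 := inv_ne_zero (by exact_mod_cast hq2.ne')
  have hq2c0 : (q 2 : ℂ) ≠ 0 := by exact_mod_cast hq2.ne'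
  -- the normalised rows
  set n' : Fin 3 → Fin 4 → ℝ := fun i => Mh.mulVec (n i) with hn'
  have hn'alg : ∀ i k, IsAlgebraic ℚ (n' i k) := fun i k => coneAux_isAlgebraic_Mh_mulVec q hq Mh hMh (hn i) k
  have hn'null : ∀ i, (fun x : Fin 4 → ℝ => x 1 ^ 2 + x 2 ^ 2 = x 0 * x 3 ∧ 0 ≤ x 3 ∧ 0 < x 0 + x 3) (n' i) := fun i => coneAux_null_Mh q hq2 Mh hMh (hnull i)
  have hrows : (fun i => Mh.mulVec (Matrix.vecCons (Ql q) n i)) = Matrix.vecCons ![(1 : ℝ), 0, 0, 1] n' := by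
    funext i
    refine Fin.cases ?_ (fun l => ?_) i
    · simp [coneAux_Mh_mulVec_apex Ql hQl q hq2 Mh hMh]
    · simp [hn']
  have hdet' : (Matrix.of (Matrix.vecCons ![(1 : ℝ), 0, 0, 1] n')).det ≠ 0 := by
    rw [← hrows, coneAux_det_of_mulVec_rows, coneAux_det_Mh q hq2 Mh hMh]
    exact mul_ne_zero hdet (by positivity)
  -- the image of the cone under `S`
  have hcov := stub_spxCovariance Ql hQl Spx hSpx S Mh (fun _ => 1)
    (by rw [coneAux_det_Mh q hq2 Mh hMh]; positivity) ?_ ?_ (Matrix.vecCons (Ql q) n)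
  rotate_left
  · intro p hp
    refine ⟨one_pos, ?_, ?_⟩
    · rw [hSa]; simpa using div_pos hp hq2
    · rw [hSa, one_smul]; exact coneAux_lift_simil Ql hQl q hq2 Mh hMh p
  · intro p' hp'
    exact ⟨S' p', by rw [hS'a]; simpa using mul_pos hq2 hp', hSS' p'⟩
  rw [hrows] at hcov
  -- the normalised statement
  obtain ⟨⟨rc, hrcd, hrci⟩, hmain⟩ := coneMain_absorption_normalised Ql hQl Spx hSpx M₀ hM₀ ρ hρ n' hn'alg hn'null hdet'
  have hsub : Spx (Matrix.vecCons (Ql q) n) ⊆ {p | 0 < p 2} := (fun p hp => by rw [hSpx] at hp; exact hp.1)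
  constructor
  · -- existence: transport `rc` back along `S'`
    have hσc : rc.domain ⊆ {p | 0 < p 2} := by rw [hrcd]; exact (fun p hp => by rw [hSpx] at hp; exact hp.1)
    obtain ⟨⟨r₀, hr₀d, hr₀i⟩, -⟩ := IsometryMove.simil_transport (η := 1) hq2c hqc hq2c0 (Or.inl rfl) S' hS' rc hσc hrci
    refine ⟨r₀, ?_, hr₀i⟩
    rw [hr₀d, hrcd, ← hcov, Set.image_image]
    have : (fun x => S' (S x)) = id := funext hS'S
    rw [this, Set.image_id]
  · intro r hr hri
    obtain ⟨⟨r₁, hr₁d, hr₁i⟩, hmove⟩ := IsometryMove.simil_transport (η := 1) hα hβ hα0 (Or.inl rfl) S hS r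
      (by rw [hr]; exact hsub) hri
    have hr₁d' : r₁.domain = Spx (Matrix.vecCons ![(1 : ℝ), 0, 0, 1] n') := by rw [hr₁d, hr, hcov]
    obtain ⟨z, e, hz, hzi, hrel⟩ := hmain r₁ hr₁d' hr₁i
    have hE : KZ.of r - KZ.of r₁ ∈ KZ.relations := hmove r₁ hr₁d hr₁i
    refine ⟨3, z, e, hz, hzi, ?_⟩
    have key : 2 • KZ.of r - ∑ i, e i • KZ.of (ρ (z i)) =
        2 • (KZ.of r - KZ.of r₁) + (2 • KZ.of r₁ - ∑ i, e i • KZ.of (ρ (z i))) := by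
      rw [smul_sub]; abel
    rw [key]
    exact add_mem (nsmul_mem hE 2) hrel

/-- **Registered stub `stub_coneAbsorptionTwo`** (LEAD-HELD; Dupont–Sah's lune argument inside the calculus): a
`ℚ̄`-cone carries a representation with integrand `t⁻³`, and TWICE its class is a `ℤ`-combination of standard
ideal tetrahedra modulo the moves. [cite: DupontSah1982, §3] -/
theorem stub_coneAbsorptionTwo :
    ∀ (Ql : (Fin 3 → ℝ) → Fin 4 → ℝ), (∀ p, Ql p = ![p 0 ^ 2 + p 1 ^ 2 + p 2 ^ 2, p 0, p 1, 1]) →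
    ∀ (Spx : (Fin 4 → Fin 4 → ℝ) → Set (Fin 3 → ℝ)),
      (∀ v, Spx v = {p | 0 < p 2 ∧ ∀ a, 0 < (Matrix.of v).det * ((Matrix.of v).updateRow a (Ql p)).det}) →
    ∀ (ρ : ℂ → KZ.IntegralRep 3),
      (∀ z, IsAlgebraic ℚ z → 0 < z.im →
        (ρ z).domain = idealTetrahedron z ∧ EqOn (ρ z).integrand (fun p => 1 / p 2 ^ 3) (idealTetrahedron z)) →
    ∀ (q : Fin 3 → ℝ), (∀ i, IsAlgebraic ℚ (q i)) → 0 < q 2 →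
    ∀ (n : Fin 3 → Fin 4 → ℝ), (∀ i j, IsAlgebraic ℚ (n i j)) →
      (∀ i, n i 1 ^ 2 + n i 2 ^ 2 = n i 0 * n i 3 ∧ 0 ≤ n i 3 ∧ 0 < n i 0 + n i 3) →
      (Matrix.of (Matrix.vecCons (Ql q) n)).det ≠ 0 →
      (∃ r : KZ.IntegralRep 3, r.domain = Spx (Matrix.vecCons (Ql q) n) ∧
        EqOn r.integrand (fun p => 1 / p 2 ^ 3) r.domain) ∧
      (∀ r : KZ.IntegralRep 3, r.domain = Spx (Matrix.vecCons (Ql q) n) →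
        EqOn r.integrand (fun p => 1 / p 2 ^ 3) r.domain →
        ∃ (k : ℕ) (z : Fin k → ℂ) (e : Fin k → ℤ), (∀ i, IsAlgebraic ℚ (z i)) ∧ (∀ i, 0 < (z i).im) ∧
          2 • KZ.of r - ∑ i, e i • KZ.of (ρ (z i)) ∈ KZ.relations) := by
  intro Ql hQl Spx hSpx ρ hρ q hq hq2 n hn hnull hdet
  exact coneAbsorptionTwo_pinned Ql hQl Spx hSpx _ rfl q _ rfl ρ hρ hq hq2 n hn hnull hdet


end Summit.KontsevichZagierPeriods.HyperbolicBloch.OffTetraSectorKernel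

end
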